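import Literature.Analysis.FluidPDE.BoltzmannGradLimit
import Literature.Analysis.FluidPDE.BoltzmannEquation
import Literature.Analysis.UnboundedOperators.LinearizedBoltzmann
import HarnessLib

-- provenance: harness21/H21/H21/Statements/Hilbert6/Sweep1.lean @ c1da388 (interim HEAD d8f2665); M5 mechanical rewrite
/-!
# Hilbert's sixth problem, statement sweep 1: Lanford-type limits

Family `hilbert6` (trunk FluidKinetic / T-KINETIC), namespace `Literature.Hilbert6`. Covered ids:

* **hilbert6.S08** (definition-role; Grad 1949, GST 2013 §2.3–2.4, Sznitman 1991 Prop. 2.2):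
  the Boltzmann–Grad scaling and the two modes of convergence are the prelude notions
  `Kinetic.IsBoltzmannGradSequence(Exact)`, `Kinetic.TendstoMarginals` /
  `Kinetic.PropagatesChaos` (mode A) and `Kinetic.TendstoEmpirical` (mode B); here we record
  the unfolding lemma `isBoltzmannGradSequence_iff`, `N_k → ∞` (`boltzmannGrad_tendsto_atTop`),
  mode A ⇒ mode B on the torus (`propagatesChaos_imp_tendstoEmpirical_torus`) and Lanford's
  theorem in mode B for the canonical ensemble (`lanford_tendstoEmpirical`).
* **hilbert6.S02** (Lanford's theorem, GST 2013 Thm 8): stated here as `lanford` (elsewhere in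
  the library this id is only *cross-referenced*, in the docstring of `ukai_lanford_lwp`,
  `Statements/Hilbert6/BoltzmannSolutions`, and in `Statements/Hilbert6/ShortRangePotentials`,
  which refers to `Hilbert6.lanford` of this file); it is the common trunk of S01, S03, S20
  below and uses literally the data class of hilbert6.S13 (`IsLanfordDatum`).
* **hilbert6.S01** (long-time derivation; Deng–Hani–Ma, arXiv:2408.07818 (2024) Thm 1 on
  `ℝ^d`, `d ≥ 2`, and arXiv:2503.01800 (2025) on `T^d`, `d ∈ {2, 3}` — recent claims, hence
  recorded as the propositions `LongTimeBoltzmannGradLimitEuclidean d`,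
  `LongTimeBoltzmannGradLimit d : Prop`, not asserted), with DHM's class of Boltzmann
  solutions bundled as the hypothesis structure `IsDHMAdmissibleSolution`.
* **hilbert6.S03** (Illner–Pulvirenti 1986/89, CIP 1994 §4.5 Thm 4.5.1): global validity in `ℝ^d`,
  `d ∈ {2, 3}`, for a small gas cloud in vacuum (`illner_pulvirenti`).
* **hilbert6.S20** (irreversibility; CIP 1994 §4.7, Bodineau–Gallagher–Saint-Raymond–Simonella,
  *One-sided convergence in the Boltzmann–Grad limit*, Ann. Fac. Sci. Toulouse 27 (2018) —
  the inventory cites this survey as "EMS Surv. (2018) §?"; the Toulouse reference is the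
  published venue of the paper so named): (i) convergence of the correlation functions
  survives velocity reversal at time `t₁`, the limit being the *backward* Boltzmann flow
  `τ ↦ f(t₁ - τ, x, -v)` (`tendstoCorrelations_gcReversed`, pure microscopic reversibility);
  (ii) that flow solves the Boltzmann equation with the *opposite* sign of the collision
  operator (`isMildBoltzmannSolutionOn_reversed`); (iii) the negative clause: it is a solution
  of the forward equation only if the collision operator vanishes identically along `f` on
  `[0, t₁]`, i.e. only in local equilibrium (`collisionOp_eq_zero_of_reversedSolution`). Hence
  Lanford's forward statement fails for the reversed data although these are asymptotically
  chaotic. NOT typed: the inventory's clause "but not for the full `N`-particle density in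
  strong norms" (non-convergence of `W_N(t)` to a chaotic state in `L¹`/entropy sense) is
  rendered only through (i)–(iii), not as a separate strong-norm statement.
* **hilbert6.S14** (partially: the *equilibrium* covariance of the fluctuation field is
  governed by the linearised Boltzmann equation, Bodineau–Gallagher–Saint-Raymond–Simonella,
  CPAM 76 (2023) *Long-time correlations for a hard-sphere gas at equilibrium* =
  arXiv:2012.03813 (bib key `BGSSCPAM2023`), Thm 1.1: all times, periodic box, `d ≥ 3`):
  `fluctuationCovariance_tendsto`. RESTATED 2026-08-15 (verdict clean-up of the discharge
  attempt): the statement is now confined to the printed range `d ≥ 3` (the `d = 2` analogue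
  is printed only for the canonical ensemble, Bodineau–Gallagher–Saint-Raymond, Ann. PDE 3
  (2017) = `BGSR2017`, Thm 1.2 / Cor. 1.2, and is merely announced as adaptable in
  `BGSSCPAM2023` Remark 1.1), and the uniform bound `sup |g| < ∞` formerly imposed on the
  linearised solution — not in the source (Remark 1.1: `L²_M` control only) and false for
  generic data — is replaced by the printed `L²_M` energy bound (`BGSR2017` Prop. 9.2).

Not covered, with the missing notion:

* hilbert6.S14, remaining parts: convergence *in law* of the fluctuation field to the
  generalised Ornstein–Uhlenbeck process (needs the field as a random element of
  `D([0,T]; 𝒮')` and the OU process driven by the fluctuating Boltzmann equation, i.e. the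
  linearised Boltzmann *semigroup* with its noise covariance — no semigroup of the unbounded
  operator `-v·∇ₓ + L` in H21/Mathlib), the non-equilibrium short-time version (needs the
  linearisation around a time-dependent `f(t)`), and the large-deviation functional.
* hilbert6.S22 is covered in `Statements/Hilbert6/ShortRangePotentials` (potential case,
  Lorentz gas, tagged sphere: linear Boltzmann and Brownian limits) and is not restated here.

## Sources

* O. E. Lanford, *Time evolution of large classical systems*, LNP 38 (1975).
* I. Gallagher, L. Saint-Raymond, B. Texier, *From Newton to Boltzmann* (2013), §2.3–2.4,
  Thm 8.
* Y. Deng, Z. Hani, X. Ma, *Long time derivation of the Boltzmann equation from hard sphere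
  dynamics*, arXiv:2408.07818 (2024), Thm 1; *Hilbert's sixth problem: derivation of fluid
  equations via Boltzmann's kinetic theory*, arXiv:2503.01800 (2025) (torus, `d ∈ {2, 3}`).
* R. Illner, M. Pulvirenti, CMP 105 (1986) 189–203; CMP 121 (1989) 143–146; C. Cercignani,
  R. Illner, M. Pulvirenti, *The Mathematical Theory of Dilute Gases* (1994) §4.4–4.7 (Thm 4.4.1
  p. 77: Lanford; §4.5, Thm 4.5.1 p. 88: rare cloud in vacuum; §4.7 pp. 95–100: irreversibility)
  and Thm 5.2.2 p. 137; R. Illner, M. Shinbrot, CMP 95 (1984) 217–226.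
* T. Bodineau, I. Gallagher, L. Saint-Raymond, S. Simonella, *One-sided convergence in the
  Boltzmann–Grad limit*, Ann. Fac. Sci. Toulouse Math. (6) 27 (2018) 985–1022.
* T. Bodineau, I. Gallagher, L. Saint-Raymond, S. Simonella, *Statistical dynamics of a hard
  sphere gas: fluctuating Boltzmann equation and large deviations*, Ann. Math. 198 (2023);
  *Long-time correlations for a hard-sphere gas at equilibrium*, CPAM 76 (2023) 3852–3911
  (arXiv:2012.03813), Thm 1.1 and Remark 1.1.
* T. Bodineau, I. Gallagher, L. Saint-Raymond, *From hard sphere dynamics to the Stokes–Fourier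
  equations: an L² analysis of the Boltzmann–Grad limit*, Ann. PDE 3 (2017) (arXiv:1511.03057),
  Thm 1.2, Cor. 1.2 (`d = 2`, canonical ensemble) and Prop. 9.2 (well-posedness of the linearised
  Boltzmann equation in `C(ℝ⁺; L²(M dv dx))` with the energy inequality, any `d ≥ 2`).
* A.-S. Sznitman, *Topics in propagation of chaos*, LNM 1464 (1991), Prop. 2.2.

## Design choices

* Grand-canonical particle systems use K3's convention (`Kinetic.gcInitial`,
  `Kinetic.correlationFn`), in the Boltzmann–Grad scaling `μ_ε ε^{d-1} = 1` (`bgActivity`),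
  i.e. `α = 1`: a general `α` is absorbed into `f₀ ↦ α f₀` (the Boltzmann equation is quadratic
  and `correlationFn` scales like `μ^{-s}`), so this is no loss of generality.
* Each `N`-sector evolves by its own hard-sphere flow (`gcEvolved`); flows are quantified
  universally (`∀ Φ`, they are Liouville-a.e. unique, `HardSphereFlow.flow_eq_ae`) along a
  sequence `ε_k → 0⁺` (with `ε_k < 1/2` on the unit torus, where the prelude flow exists).
  Exactly as in K3's `Kinetic.liouville_imp_bbgky`, the transported sector is *restricted to
  the good set of the flow* (`(Φ N).good.indicator (hsTransport …)`): the prelude flow is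
  unspecified (junk) off its good set, whose complement in `(X × ℝ^d)^N` has infinite Lebesgue
  measure, so without the indicator the junk would pollute the `Z_p`-integrals defining the
  correlation functions. With it, the transported state is determined up to the Liouville-null
  set `D_ε^N ∖ good`, which the a.e.-versions (`TendstoCorrelations`), the `L¹` norm (DHM) and
  the sector integrals (`gcExpectation`) absorb.
* The correlation functions of the transported state are only determined almost everywhere,
  whereas mode A tests suprema over compact sets of positions; we therefore assert the
  existence of *versions* (`=ᵐ` for every `k, s, t`) converging in mode A
  (`TendstoCorrelations`).
* Lanford data are exactly the data of `ukai_lanford_lwp` (hilbert6.S13):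
  `0 ≤ f₀`, `Kinetic.MemLanford β₀ f₀`, `Kinetic.eGaussSupNorm β₀ f₀ ≤ C₀` (`IsLanfordDatum`);
  the limit is the mild solution in `C([0,T]; X_{β₀/2})` (`Kinetic.ContinuousInLanfordOn`,
  `Kinetic.IsMildBoltzmannSolutionOn`, kernel `hardSphereKernel`, whole-sphere convention).
  All Gaussian weights follow the prelude's `e^{-β|·|²/2}` convention.
* S03 and S14 are stated for the grand-canonical ensembles of the modern references (GST,
  BGSS); Illner–Pulvirenti / CIP §4.5 use the canonical `N`-particle ensemble, a standard
  variant with the same limit.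
-/

open MeasureTheory Metric Real Set Filter Topology Function
open scoped ENNReal Nat

namespace Literature.MathematicalPhysics.KineticTheory

noncomputable section

variable {d : Type*} [Fintype d]

/-! ## Glue: evolved grand-canonical states and convergence of their correlation functions -/

section Glue

variable {X : Type*} [MeasureSpace X] [TopologicalSpace X]

/-- The Boltzmann–Grad activity `μ_ε = ε^{-(d-1)}` of the grand-canonical state (GST 2013 §6.1,
BGSS 2023 (1.1.4): `μ_ε ε^{d-1} = 1`). `ℕ`-subtraction in the exponent; used with `2 ≤ d`. [cite: GST2013, §6.1  BGSS 2023 (1.1.4] -/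
def bgActivity (d : Type*) [Fintype d] (ε : ℝ) : ℝ :=
  ε⁻¹ ^ (Fintype.card d - 1)

/-- The grand-canonical state at time `t`: each `N`-particle sector of `W` is transported by
its hard-sphere flow, `W_N(t) = W_N ∘ Φ^N_{-t}`, *restricted to the good set of the flow* (value
`0` off it; the flow is junk there, and `D_ε^N ∖ good` is Liouville-null), as in
`Kinetic.liouville_imp_bbgky` (GST 2013 §4.2, (6.1.4); BGSS 2023 §1.1). [cite: GST2013, §4.2  (6.1.4] -/
def gcEvolved {G : Literature.Analysis.FluidPDE.Geometry d X} {ε : ℝ} (Φ : (N : ℕ) → Literature.Analysis.FluidPDE.HardSphereFlow G ε N)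
    (W : Literature.Analysis.FluidPDE.GCState d X) (t : ℝ) : Literature.Analysis.FluidPDE.GCState d X :=
  fun N => (Φ N).good.indicator (Literature.Analysis.FluidPDE.hsTransport (Φ N) t (W N))

/-- *Convergence of the rescaled correlation functions in mode A along a sequence.* For
diameters `ε_k`, flows `Φ k N`, activities `μ_k` and initial grand-canonical states `W₀ k`,
the time-evolved rescaled correlation functions
`F_k^{(s)}(t) = correlationFn μ_k (W₀ k transported to time t) s` admit versions (they are
determined only a.e.) which converge in the sense of observables, locally uniformly off the
position diagonal and uniformly on `[0, T]`, to `f(t)^{⊗s}` for every `s`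
(`Kinetic.PropagatesChaos`; GST 2013 Thm 8: "uniformly on compact sets outside a measure-zero
set of configurations"). Named after the prelude's `TendstoMarginals` / `TendstoEmpirical`. [cite: GST2013, Thm 8: "uniformly on compact sets outsid] -/
def TendstoCorrelations {G : Literature.Analysis.FluidPDE.Geometry d X} {ε : ℕ → ℝ}
    (Φ : (k N : ℕ) → Literature.Analysis.FluidPDE.HardSphereFlow G (ε k) N) (μ : ℕ → ℝ)
    (W₀ : ℕ → Literature.Analysis.FluidPDE.GCState d X) (f : ℝ → X × EuclideanSpace ℝ d → ℝ) (T : ℝ) : Prop :=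
  ∃ F : ℕ → (s : ℕ) → ℝ → Literature.Analysis.FluidPDE.Config s d X → ℝ,
    (∀ k s, ∀ t ∈ Icc 0 T,
      F k s t =ᵐ[volume] Literature.Analysis.FluidPDE.correlationFn (μ k) (gcEvolved (Φ k) (W₀ k) t) s) ∧
    Literature.Analysis.FluidPDE.PropagatesChaos F f T

/-- Lanford's class of initial data (GST 2013 Thm 8), spelled exactly as the hypotheses of
`ukai_lanford_lwp` (hilbert6.S13): `f₀ ≥ 0`, `f₀` continuous with finite Gaussian sup norm
(`Kinetic.MemLanford β₀ f₀`) and `‖f₀‖_{β₀} = sup e^{β₀|v|²/2} |f₀(x, v)| ≤ C₀`, i.e.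
`0 ≤ f₀ ≤ C₀ e^{-β₀|v|²/2}` (the finiteness clause inside `MemLanford` is then redundant but
kept for literal agreement with S13). [cite: GST2013, Thm 8] -/
def IsLanfordDatum (β₀ C₀ : ℝ) (f₀ : X → EuclideanSpace ℝ d → ℝ) : Prop :=
  (∀ x v, 0 ≤ f₀ x v) ∧ Literature.Analysis.FluidPDE.MemLanford β₀ f₀ ∧
    Literature.Analysis.FluidPDE.eGaussSupNorm β₀ f₀ ≤ ENNReal.ofReal C₀

end Glue

/-! ## hilbert6.S08: the Boltzmann–Grad scaling and the modes of convergence -/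

section Scaling

/-- **hilbert6.S08** (the Boltzmann–Grad scaling; Grad 1949; GST 2013 §2.3, (2.3.1)). A
sequence `(N_k, ε_k)` is in the Boltzmann–Grad scaling with parameter `α` iff `ε_k > 0`,
`ε_k → 0` and `N_k ε_k^{d-1} → α` (so that the mean free path `(N ε^{d-1})⁻¹` is of order one);
this is the prelude's `Kinetic.IsBoltzmannGradSequence` (unfolding lemma). The two modes of
convergence of the inventory item are the prelude's `Kinetic.TendstoMarginals` /
`Kinetic.PropagatesChaos` (marginals, tested against velocity observables, uniformly on
`[0, T]` and locally uniformly off the position diagonal; GST 2013 Thm 8) and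
`Kinetic.TendstoEmpirical` (empirical measure `N⁻¹ ∑ δ_{z_i(t)} → f(t) dx dv` in probability;
Sznitman 1991 Prop. 2.2). [cite: Grad1949] -/
theorem isBoltzmannGradSequence_iff (α : ℝ) (N : ℕ → ℕ) (ε : ℕ → ℝ) :
    Literature.Analysis.FluidPDE.IsBoltzmannGradSequence d α N ε ↔
      (∀ k, 0 < ε k) ∧ Tendsto ε atTop (𝓝 0) ∧
        Tendsto (fun k => (N k : ℝ) * ε k ^ (Fintype.card d - 1)) atTop (𝓝 α) :=
  Iff.rfl

/-- **hilbert6.S08** (GST 2013 §2.3): in the Boltzmann–Grad scaling with `α ≠ 0` and `d ≥ 2`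
the number of particles diverges, `N_k → ∞`. The prelude's
`Kinetic.IsBoltzmannGradSequence.tendsto_atTop`. [cite: GST2013, §2.3] -/
theorem boltzmannGrad_tendsto_atTop (hd : 2 ≤ Fintype.card d) {α : ℝ} (hα : α ≠ 0)
    {N : ℕ → ℕ} {ε : ℕ → ℝ} (h : Literature.Analysis.FluidPDE.IsBoltzmannGradSequence d α N ε) :
    Tendsto N atTop atTop :=
  h.tendsto_atTop hd hα

/-- **hilbert6.S08** (mode A ⇒ mode B on the torus: propagation of chaos implies the law of
large numbers for the empirical measure; Sznitman, LNM 1464 (1991) Prop. 2.2; GST 2013 §2.4).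
For symmetric measurable probability densities `W_k` of `N_k → ∞` hard spheres on
`T^d × ℝ^d` supported in `D_{ε_k}^{N_k}`, if the marginals of the transported densities
converge in mode A on `[0, T]` to `f(t)^{⊗s}` with `f(t)` a probability density, then the
empirical measure at each time `t ∈ [0, T]` converges in probability to `f(t) dx dv`. The
torus case of the prelude's `Kinetic.TendstoMarginals.tendstoEmpirical`, the standing
hypothesis "points are Lebesgue-null" being `Kinetic.nullSingletonClass_volume_unitAddTorus`.
(The hypothesis `h` is inherited verbatim from the prelude and uses the raw transported
density `hsTransport`, without the good-set indicator of `gcEvolved`; on the hypothesis side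
this is harmless.) [cite: GST2013, §2.4] -/
def propagatesChaos_imp_tendstoEmpirical_torus : Prop :=
  ∀ [Nonempty d] {Nk : ℕ → ℕ} {εk : ℕ → ℝ} (hN : Tendsto Nk atTop atTop) (Φk : (k : ℕ) → Literature.Analysis.FluidPDE.HardSphereFlow (Literature.Analysis.FluidPDE.Torus.geometry d) (εk k) (Nk k)) {Wk : (k : ℕ) → Literature.Analysis.FluidPDE.Config (Nk k) d (UnitAddTorus d) → ℝ} (hWs : ∀ k, Literature.Analysis.FluidPDE.IsSymmetricFn (Wk k)) (hWm : ∀ k, Measurable (Wk k)) (hW0 : ∀ k, 0 ≤ Wk k) (hWD : ∀ k, ∀ z ∉ Literature.Analysis.FluidPDE.hardSphereDomain (Literature.Analysis.FluidPDE.Torus.geometry d) (Nk k) (εk k), Wk k z = 0) (hW1 : ∀ k, ∫ z, Wk k z = 1) {f : ℝ → UnitAddTorus d × EuclideanSpace ℝ d → ℝ} {T : ℝ} (hf0 : ∀ t ∈ Icc 0 T, 0 ≤ f t) (hf1 : ∀ t ∈ Icc 0 T, ∫ x : UnitAddTorus d, ∫ v : EuclideanSpace ℝ d, f t (x, v) =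 1) (h : Literature.Analysis.FluidPDE.PropagatesChaos (fun k s t => Literature.Analysis.FluidPDE.nthMarginal (Nk k) s (Literature.Analysis.FluidPDE.hsTransport (Φk k) t (Wk k))) f T),
    Literature.Analysis.FluidPDE.TendstoEmpirical Nk (fun k => Literature.Analysis.FluidPDE.particleLaw (Φk k) (Wk k))
      (fun k => (Φk k).flow) f T

/- interim proof relied on results that are now named facts (D-0014); demoted to a fact by the M5 import, proof preserved:
:= by
  haveI := Kinetic.nullSingletonClass_volume_unitAddTorus d
  exact Kinetic.TendstoMarginals.tendstoEmpirical hN Φk hWs hWm hW0 hWD hW1 hf0 hf1 h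
-/

end Scaling

/-! ## hilbert6.S02: Lanford's theorem on `T^d` -/

section Lanford

/-- **hilbert6.S02** (Lanford's theorem for hard spheres on `T^d`; Lanford, LNP 38 (1975);
Cercignani–Illner–Pulvirenti 1994 Thm 4.4.1 (p. 77); Gallagher–Saint-Raymond–Texier 2013 Thm 8). Let
`d ≥ 2`, `β₀ > 0`, `C₀ > 0`. There is a time `T = T(d, β₀, C₀) > 0` (a fraction of the mean free
time) such that for every Lanford datum `f₀` (`0 ≤ f₀`, continuous, `‖f₀‖_{β₀} ≤ C₀`, i.e.
`f₀ ≤ C₀ e^{-β₀|v|²/2}`; `IsLanfordDatum`): the hard-sphere Boltzmann equation on `T^d` has a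
mild solution `f ∈ C([0,T]; X_{β₀/2})` with `f(0) = f₀` (the Ukai–Lanford solution of
hilbert6.S13, same hypotheses), and for every sequence of diameters `ε_k → 0⁺`
(`ε_k < 1/2`), grand-canonical Gibbs-type data `gcInitial (Torus.geometry d) ε_k μ_k f₀` in the
Boltzmann–Grad scaling `μ_k ε_k^{d-1} = 1` and hard-sphere flows `Φ k N`, the time-evolved
rescaled correlation functions `F_k^{(s)}(t)` converge (in versions, mode A: uniformly on
`[0, T]`, locally uniformly off the position diagonal after testing against compactly supported
continuous velocity observables) to `f(t)^{⊗s}` for every `s` (`TendstoCorrelations`). [cite: CercignaniIllnerPulvirenti1994, Thm 4.4.1 (p. 77)] -/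
def lanford : Prop :=
  ∀ (hd : 2 ≤ Fintype.card d) {β₀ C₀ : ℝ} (hβ₀ : 0 < β₀) (hC₀ : 0 < C₀),
    ∃ T > (0 : ℝ), ∀ f₀ : UnitAddTorus d → EuclideanSpace ℝ d → ℝ, IsLanfordDatum β₀ C₀ f₀ →
      ∃ f : ℝ → UnitAddTorus d → EuclideanSpace ℝ d → ℝ,
        Literature.Analysis.FluidPDE.ContinuousInLanfordOn (Icc 0 T) (β₀ / 2) f ∧
        Literature.Analysis.FluidPDE.IsMildBoltzmannSolutionOn T (Literature.Analysis.FluidPDE.Torus.geometry d) hardSphereKernel f ∧ f 0 = f₀ ∧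
        ∀ ε : ℕ → ℝ, (∀ k, 0 < ε k) → (∀ k, ε k < 2⁻¹) → Tendsto ε atTop (𝓝 0) →
          ∀ Φ : (k N : ℕ) → Literature.Analysis.FluidPDE.HardSphereFlow (Literature.Analysis.FluidPDE.Torus.geometry d) (ε k) N,
            TendstoCorrelations Φ (fun k => bgActivity d (ε k))
              (fun k => Literature.Analysis.FluidPDE.gcInitial (Literature.Analysis.FluidPDE.Torus.geometry d) (ε k) (bgActivity d (ε k))
                (uncurry f₀))
              (fun t z => f t z.1 z.2) T

/-- **hilbert6.S08** (Lanford's theorem in mode B, canonical ensemble; Lanford 1975, CIP 1994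
Thm 4.4.1 (p. 77) with §4.2's canonical measures; GST 2013 §2.4; Sznitman 1991 Prop. 2.2). Let
`d ≥ 2`, `β₀ > 0`, `C₀ > 0`. There is a time `T > 0` (which may be taken to be Lanford's time
`T(d, β₀, C₀)` of `lanford`) such that for every Lanford datum `f₀` that is moreover a
probability density, the Ukai–Lanford mild solution `f` on `[0, T]` with `f(0) = f₀` exists
and: for `N_k` hard spheres of diameter `ε_k < 1/2` on `T^d` in the exact Boltzmann–Grad
scaling `N_k ε_k^{d-1} = 1`, initially distributed with the canonical Gibbs-type density
`𝒵_N⁻¹ 1_{D_ε^N} f₀^{⊗N}` (`Kinetic.canonicalDensity`), the empirical measure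
`N_k⁻¹ ∑ᵢ δ_{z_i(t)}` converges in probability to `f(t, x, v) dx dv` for every `t ∈ [0, T]`
(`Kinetic.TendstoEmpirical`; the law `Kinetic.particleLaw` is Liouville-absolutely continuous,
so the junk of the flow off its good set is invisible). This links the two modes of convergence
of hilbert6.S08 on Lanford's theorem itself. [cite: Lanford1975, CIP 1994 Thm 4.4.1 (p. 77) with §4.2's canonical measures] -/
def lanford_tendstoEmpirical : Prop :=
  ∀ [Nonempty d] (hd : 2 ≤ Fintype.card d) {β₀ C₀ : ℝ} (hβ₀ : 0 < β₀) (hC₀ : 0 < C₀),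
    ∃ T > (0 : ℝ), ∀ f₀ : UnitAddTorus d → EuclideanSpace ℝ d → ℝ, IsLanfordDatum β₀ C₀ f₀ →
      ∫ x, ∫ v, f₀ x v = 1 →
      ∃ f : ℝ → UnitAddTorus d → EuclideanSpace ℝ d → ℝ,
        Literature.Analysis.FluidPDE.ContinuousInLanfordOn (Icc 0 T) (β₀ / 2) f ∧
        Literature.Analysis.FluidPDE.IsMildBoltzmannSolutionOn T (Literature.Analysis.FluidPDE.Torus.geometry d) hardSphereKernel f ∧ f 0 = f₀ ∧
        ∀ (N : ℕ → ℕ) (ε : ℕ → ℝ), Literature.Analysis.FluidPDE.IsBoltzmannGradSequenceExact d 1 N ε →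
          (∀ k, ε k < 2⁻¹) →
          ∀ Φ : (k : ℕ) → Literature.Analysis.FluidPDE.HardSphereFlow (Literature.Analysis.FluidPDE.Torus.geometry d) (ε k) (N k),
            Literature.Analysis.FluidPDE.TendstoEmpirical N
              (fun k => Literature.Analysis.FluidPDE.particleLaw (Φ k)
                (Literature.Analysis.FluidPDE.canonicalDensity (Literature.Analysis.FluidPDE.Torus.geometry d) (ε k) (N k) (uncurry f₀)))
              (fun k => (Φ k).flow) (fun t z => f t z.1 z.2) T

end Lanford

/-! ## hilbert6.S01: the long-time Boltzmann–Grad limit (Deng–Hani–Ma) -/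

section LongTime

variable {X : Type*} [PseudoMetricSpace X]

/-- *Deng–Hani–Ma's class of Boltzmann solutions on `[0, T]`* (arXiv:2408.07818 Thm 1, the
"required class" of hilbert6.S01), bundled as a hypothesis structure on a geometry `G` (torus
or whole space): `f` is a mild solution of the hard-sphere Boltzmann equation, continuous in
time with values in the Gaussian-weighted space `X_β` (`‖e^{β|v|²/2} f(t)‖_{L^∞_{x,v}}` finite
and continuous in `t`), and its position gradient obeys the same Gaussian bound uniformly on
`[0, T]`, `‖e^{β|v|²/2} ∇ₓ f‖_{L^∞([0,T] × X × ℝ^d)} ≤ A`, written as a weighted Lipschitz bound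
in `x` (equivalent to the `W^{1,∞}_x` bound by Rademacher). On the torus we use Mathlib's
(sup-)distance `dist` on the pi-type `UnitAddTorus d = d → AddCircle 1`; it is equivalent to
the minimal-image Euclidean distance up to the factor `√d`, absorbed into `A`. DHM state the
weights as `e^{β|v|²}` on both `n` and `∇ₓ n`; the precise exponent convention / constant is
flagged `?` (immaterial up to renaming `β`). [claim: DengHaniMa2024, status: under-review] -/
structure IsDHMAdmissibleSolution (G : Literature.Analysis.FluidPDE.Geometry d X) (T β : ℝ)
    (f : ℝ → X → EuclideanSpace ℝ d → ℝ) : Prop where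
  /-- `f` is a mild solution of the hard-sphere Boltzmann equation on `[0, T]`. -/
  mild : Literature.Analysis.FluidPDE.IsMildBoltzmannSolutionOn T G hardSphereKernel f
  /-- `f ∈ C([0, T]; X_β)` (Gaussian-weighted sup norm). -/
  continuousInLanford : Literature.Analysis.FluidPDE.ContinuousInLanfordOn (Icc 0 T) β f
  /-- Gaussian-weighted `W^{1,∞}` bound in the position variable, uniformly on `[0, T]` (`?`). -/
  lipschitz : ∃ A : ℝ, ∀ t ∈ Icc 0 T, ∀ x y v,
    |f t x v - f t y v| ≤ A * dist x y * exp (-(β / 2) * ‖v‖ ^ 2)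

/-- The common conclusion of the long-time statements: along diameters `ε_k → 0⁺` with
grand-canonical Gibbs-type data of density `f(0)` in the scaling `μ_k ε_k^{d-1} = 1` and
hard-sphere flows `Φ k N` on the geometry `G`, the time-evolved rescaled `s`-particle
correlation functions converge to `f(t)^{⊗s}` in `L¹((X × ℝ^d)^s)` for every `s` and every
`t ∈ [0, T]` (DHM 2024 Thm 1, without its quantitative rate `ε^θ` for `s ≤ |log ε|`). The
`L¹` norm does not see the Liouville-null ambiguity of `gcEvolved`. [cite: DHM2024, Thm 1  without its quantitative rate  ε^] -/
def TendstoCorrelationsL1 [MeasureSpace X] (G : Literature.Analysis.FluidPDE.Geometry d X) {ε : ℕ → ℝ}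
    (Φ : (k N : ℕ) → Literature.Analysis.FluidPDE.HardSphereFlow G (ε k) N) (f : ℝ → X → EuclideanSpace ℝ d → ℝ)
    (T : ℝ) : Prop :=
  ∀ s : ℕ, ∀ t ∈ Icc 0 T,
    Tendsto (fun k => eLpNorm
      (Literature.Analysis.FluidPDE.correlationFn (bgActivity d (ε k))
          (gcEvolved (Φ k) (Literature.Analysis.FluidPDE.gcInitial G (ε k) (bgActivity d (ε k)) (uncurry (f 0))) t)
          s -
        Literature.Analysis.FluidPDE.tensorPow s (fun z => f t z.1 z.2)) 1 volume) atTop (𝓝 0)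

/-- **hilbert6.S01** (long-time Boltzmann–Grad limit in the whole space; Deng–Hani–Ma,
arXiv:2408.07818 (2024) Thm 1 — a recent claim, recorded as a proposition and not asserted;
Hilbert 1900, Problem 6). Let `d ≥ 2`, `β > 0`, `T > 0`, and let `f` be a solution of the
hard-sphere Boltzmann equation on `ℝ^d` on `[0, T]` in DHM's class
(`IsDHMAdmissibleSolution`: mild, Gaussian-weighted `L^∞` bounds on `f` and `∇ₓ f`) whose datum
`f₀ = f(0)` is integrable (finite expected particle number `μ_ε ∫ f₀`; DHM's precise decay
hypotheses in `x` are flagged `?`). For hard spheres of diameter `ε_k → 0⁺` with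
grand-canonical Gibbs-type data of density `f₀` in the Boltzmann–Grad scaling
`μ_k ε_k^{d-1} = 1` (general `α` being absorbed into `f₀`) and hard-sphere flows `Φ k N`, the
time-evolved rescaled correlation functions converge to `f(t)^{⊗s}` in `L¹` for every `s` and
every `t ∈ [0, T]` — on the whole interval on which the Boltzmann solution exists in the
class, not only for Lanford's fraction of the mean free time. (Stated as an implication from
`2 ≤ card d`, hence trivially true for `card d < 2`, outside the printed range.) [claim: DengHaniMa2024, status: under-review] -/
def LongTimeBoltzmannGradLimitEuclidean (d : Type*) [Fintype d] : Prop :=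
  2 ≤ Fintype.card d →
    ∀ (β T : ℝ), 0 < β → 0 < T →
    ∀ f : ℝ → EuclideanSpace ℝ d → EuclideanSpace ℝ d → ℝ,
      IsDHMAdmissibleSolution (Literature.Analysis.FluidPDE.Euclidean.geometry d) T β f → Integrable (uncurry (f 0)) →
    ∀ ε : ℕ → ℝ, (∀ k, 0 < ε k) → Tendsto ε atTop (𝓝 0) →
    ∀ Φ : (k N : ℕ) → Literature.Analysis.FluidPDE.HardSphereFlow (Literature.Analysis.FluidPDE.Euclidean.geometry d) (ε k) N,
      TendstoCorrelationsL1 (Literature.Analysis.FluidPDE.Euclidean.geometry d) Φ f T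

/-- **hilbert6.S01** (long-time Boltzmann–Grad limit on the torus; Deng–Hani–Ma,
arXiv:2503.01800 (2025), the periodic extension of arXiv:2408.07818 Thm 1, stated there for
`d ∈ {2, 3}` — a recent claim, recorded as a proposition and not asserted; the inventory's
"`T^d`, `d ≥ 2` ?" is resolved by restricting to the printed range). Let `d ∈ {2, 3}`,
`β > 0`, `T > 0`, and let `f` be a solution of the hard-sphere Boltzmann equation on `T^d` on
`[0, T]` in DHM's class (`IsDHMAdmissibleSolution`). For hard spheres of diameter `ε_k → 0⁺`
(`ε_k < 1/2`) with grand-canonical Gibbs-type data of density `f(0)` in the scaling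
`μ_k ε_k^{d-1} = 1` and hard-sphere flows `Φ k N`, the time-evolved rescaled correlation
functions converge to `f(t)^{⊗s}` in `L¹((T^d × ℝ^d)^s)` for every `s` and `t ∈ [0, T]`.
(Stated as an implication from the dimension hypothesis, hence trivially true outside the
printed dimensions `d ∈ {2, 3}`.) [claim: DengHaniMa2024, status: under-review] -/
def LongTimeBoltzmannGradLimit (d : Type*) [Fintype d] : Prop :=
  (Fintype.card d = 2 ∨ Fintype.card d = 3) →
    ∀ (β T : ℝ), 0 < β → 0 < T →
    ∀ f : ℝ → UnitAddTorus d → EuclideanSpace ℝ d → ℝ,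
      IsDHMAdmissibleSolution (Literature.Analysis.FluidPDE.Torus.geometry d) T β f →
    ∀ ε : ℕ → ℝ, (∀ k, 0 < ε k) → (∀ k, ε k < 2⁻¹) → Tendsto ε atTop (𝓝 0) →
    ∀ Φ : (k N : ℕ) → Literature.Analysis.FluidPDE.HardSphereFlow (Literature.Analysis.FluidPDE.Torus.geometry d) (ε k) N,
      TendstoCorrelationsL1 (Literature.Analysis.FluidPDE.Torus.geometry d) Φ f T

end LongTime

/-! ## hilbert6.S03: Illner–Pulvirenti, global validity for a gas cloud in vacuum -/

section IllnerPulvirenti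

/-- **hilbert6.S03** (Illner–Pulvirenti, CMP 105 (1986) (`d = 2`), CMP 121 (1989) (`d = 2, 3`);
CIP 1994 §4.5, Thm 4.5.1 (p. 88, printed for `d = 3` and the canonical ensemble `N σ² = α` with
`b α` small), the global existence part being CIP 1994 Thm 5.2.2 (p. 137) = Illner–Shinbrot, CMP 95
(1984)). Global-in-time validity of the Boltzmann–Grad limit for a rare gas cloud
expanding in the vacuum `ℝ^d`, `d ∈ {2, 3}`: for every `β₀ > 0` there is `c₀ = c₀(d, β₀) > 0`
such that for every continuous `f₀` with `0 ≤ f₀(x, v) ≤ c₀ e^{-β₀ (|x|² + |v|²) / 2}` (small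
amplitude, i.e. large mean free path; the prelude's `β/2` weight convention) the hard-sphere
Boltzmann equation on `ℝ^d` has a global mild solution `f` with `f(0) = f₀`, dispersively
bounded (`0 ≤ f(t, x, v) ≤ C e^{-β (|x - t v|² + |v|²) / 2}` for some `C`, `β > 0`), and for
*every* `T > 0`, every sequence `ε_k → 0⁺`, grand-canonical Gibbs-type data of density `f₀` in
the scaling `μ_k ε_k^{d-1} = 1` and hard-sphere flows `Φ k N` in `ℝ^d`, the time-evolved
rescaled correlation functions converge on `[0, T]` (versions, mode A) to `f(t)^{⊗s}`
(`TendstoCorrelations`). Illner–Pulvirenti and CIP §4.5 use the *canonical* `N`-particle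
ensemble `N ε^{d-1} = 1`; the grand-canonical rendering is the standard GST-style variant. [cite: CIP1994, §4.5 Thm 4.5.1 (p. 88)] -/
def illner_pulvirenti : Prop :=
  ∀ (hd : Fintype.card d = 2 ∨ Fintype.card d = 3) {β₀ : ℝ} (hβ₀ : 0 < β₀),
    ∃ c₀ > (0 : ℝ), ∀ f₀ : EuclideanSpace ℝ d → EuclideanSpace ℝ d → ℝ,
      Continuous (uncurry f₀) →
      (∀ x v, 0 ≤ f₀ x v ∧ f₀ x v ≤ c₀ * exp (-(β₀ / 2) * (‖x‖ ^ 2 + ‖v‖ ^ 2))) →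
      ∃ f : ℝ → EuclideanSpace ℝ d → EuclideanSpace ℝ d → ℝ,
        (∀ T > (0 : ℝ),
          Literature.Analysis.FluidPDE.IsMildBoltzmannSolutionOn T (Literature.Analysis.FluidPDE.Euclidean.geometry d) hardSphereKernel f) ∧
        f 0 = f₀ ∧
        (∃ C β : ℝ, 0 < β ∧ ∀ t ≥ (0 : ℝ), ∀ x v,
          0 ≤ f t x v ∧ f t x v ≤ C * exp (-(β / 2) * (‖x - t • v‖ ^ 2 + ‖v‖ ^ 2))) ∧
        ∀ T > (0 : ℝ), ∀ ε : ℕ → ℝ, (∀ k, 0 < ε k) → Tendsto ε atTop (𝓝 0) →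
          ∀ Φ : (k N : ℕ) → Literature.Analysis.FluidPDE.HardSphereFlow (Literature.Analysis.FluidPDE.Euclidean.geometry d) (ε k) N,
            TendstoCorrelations Φ (fun k => bgActivity d (ε k))
              (fun k => Literature.Analysis.FluidPDE.gcInitial (Literature.Analysis.FluidPDE.Euclidean.geometry d) (ε k) (bgActivity d (ε k))
                (uncurry f₀))
              (fun t z => f t z.1 z.2) T

end IllnerPulvirenti

/-! ## hilbert6.S20: irreversibility — one-sided convergence -/

section Irreversibility

variable {X : Type*} [MeasureSpace X] [TopologicalSpace X]

/-- The *velocity-reversed* grand-canonical state at time `t₁`: transport each sector to time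
`t₁` (restricted to the good set of the flow, as in `gcEvolved`) and flip all velocities,
`W̃_N(Z_N) = W_N(t₁)(x_N, -v_N)` (CIP 1994 §4.7; BGSS 2018 §1). By reversibility of the
hard-sphere dynamics, transporting `W̃` for a further time `τ ≤ t₁` gives (a.e.) the velocity
flip of `W(t₁ - τ)`. [cite: CIP1994, §4.7 (pp. 95–97)] -/
def gcReversed {G : Literature.Analysis.FluidPDE.Geometry d X} {ε : ℝ} (Φ : (N : ℕ) → Literature.Analysis.FluidPDE.HardSphereFlow G ε N)
    (W : Literature.Analysis.FluidPDE.GCState d X) (t₁ : ℝ) : Literature.Analysis.FluidPDE.GCState d X :=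
  fun N => gcEvolved Φ W t₁ N ∘ Literature.Analysis.FluidPDE.flipVel

/-- The backward Boltzmann flow seen after velocity reversal at time `t₁`:
`f̃(τ, x, v) = f(t₁ - τ, x, -v)`. [folklore] -/
def reversedSolution (f : ℝ → X → EuclideanSpace ℝ d → ℝ) (t₁ : ℝ) :
    ℝ → X → EuclideanSpace ℝ d → ℝ :=
  fun τ x v => f (t₁ - τ) x (-v)

/-- **hilbert6.S20** (convergence of the marginals holds in *both* time directions;
Bodineau–Gallagher–Saint-Raymond–Simonella, Ann. Fac. Sci. Toulouse 27 (2018), §1; CIP 1994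
§4.7). On `T^d`: if along a sequence of diameters `ε_k > 0` with flows `Φ k N`, activities
`μ_k` and arbitrary initial grand-canonical states `W₀ k` the time-evolved correlation
functions converge on `[0, T]` (versions, mode A) to `f(t)^{⊗s}`, then for every `t₁ ∈ (0, T]`
the correlation functions of the *velocity-reversed* states at time `t₁` (`gcReversed`),
evolved for a further time `τ ∈ [0, t₁]`, converge in the same sense to
`(f(t₁ - τ, x, -v))^{⊗s}` (`reversedSolution`). This is pure microscopic reversibility
(`Kinetic.IsHardSphereTrajectory.timeReverse`: `Φ_τ ∘ R = R ∘ Φ_{-τ}` Liouville-a.e.) plus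
invariance of mode A under the velocity flip; in particular the reversed states are
asymptotically chaotic (`τ = 0`), yet — by `isMildBoltzmannSolutionOn_reversed` and
`collisionOp_eq_zero_of_reversedSolution` below — their limit is *not* the forward Boltzmann
solution issued from `f(t₁, x, -v)` unless `f` is collision-free on `[0, t₁]`. [cite: CIP1994, §4.7 (pp. 95–97)] -/
def tendstoCorrelations_gcReversed : Prop :=
  ∀ {ε : ℕ → ℝ} (Φ : (k N : ℕ) → Literature.Analysis.FluidPDE.HardSphereFlow (Literature.Analysis.FluidPDE.Torus.geometry d) (ε k) N) (μ : ℕ → ℝ) (W₀ : ℕ → Literature.Analysis.FluidPDE.GCState d (UnitAddTorus d)) {f : ℝ → UnitAddTorus d → EuclideanSpace ℝ d → ℝ} {T : ℝ} (h : TendstoCorrelations Φ μ W₀ (fun t z => f t z.1 z.2) T) {t₁ : ℝ} (ht₁ : t₁ ∈ Ioc 0 T),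
    TendstoCorrelations Φ μ (fun k => gcReversed (Φ k) (W₀ k) t₁)
      (fun τ z => reversedSolution f t₁ τ z.1 z.2) t₁

/-- **hilbert6.S20** (the reversed Boltzmann flow solves the *backward* Boltzmann equation;
CIP 1994 §4.7). If `f` is a mild solution of the hard-sphere Boltzmann equation
`∂ₜ f + v·∇ₓ f = Q(f, f)` on `[0, T]` (torus) and `t₁ ≤ T`, then
`f̃(τ, x, v) = f(t₁ - τ, x, -v)` is a mild solution on `[0, t₁]` of
`∂_τ f̃ + v·∇ₓ f̃ = -Q(f̃, f̃)`, i.e. of the Boltzmann equation with the negated kernel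
`-((v - v_*)·ω)_+` (the hard-sphere kernel and the sphere measure are invariant under
`(v, v_*, ω) ↦ (-v, -v_*, -ω)`, and the characteristic through `(x, v)` of `f̃` is the
characteristic through `(x + t₁ v, -v)` of `f` run backwards; vacuous for `t₁ < 0`). [cite: CIP1994, §4.7 (pp. 95–97)] -/
def isMildBoltzmannSolutionOn_reversed : Prop :=
  ∀ {T t₁ : ℝ} (ht₁ : t₁ ≤ T) {f : ℝ → UnitAddTorus d → EuclideanSpace ℝ d → ℝ} (hf : Literature.Analysis.FluidPDE.IsMildBoltzmannSolutionOn T (Literature.Analysis.FluidPDE.Torus.geometry d) hardSphereKernel f),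
    Literature.Analysis.FluidPDE.IsMildBoltzmannSolutionOn t₁ (Literature.Analysis.FluidPDE.Torus.geometry d) (-hardSphereKernel)
      (reversedSolution f t₁)

/-- **hilbert6.S20** (the negative clause: the time-reversed statement fails away from
equilibrium; CIP 1994 §4.7, BGSS 2018 §1). Let `f ∈ C([0, T]; X_β)` (`β > 0`) be a mild
solution of the hard-sphere Boltzmann equation on `T^d` and `0 < t₁ ≤ T`. If the reversed flow
`f̃(τ, x, v) = f(t₁ - τ, x, -v)` — the Boltzmann–Grad limit of the velocity-reversed gas by
`tendstoCorrelations_gcReversed` — were *also* a mild solution of the (forward) hard-sphere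
Boltzmann equation on `[0, t₁]`, as Lanford's forward statement applied to the reversed,
asymptotically chaotic data would predict, then comparing the two Duhamel formulas
(`isMildBoltzmannSolutionOn_reversed`) gives `∫₀^τ Q(f̃, f̃)♯ = 0` for all `τ`, hence, by
continuity in Lanford's class, the collision operator vanishes identically along the solution:
`Q(f(τ, x, ·), f(τ, x, ·)) = 0` for all `τ ∈ [0, t₁]` and all `x`, i.e. `f` is in local
(collisional) equilibrium throughout `[0, t₁]` — zero entropy production, and by Boltzmann's
H-theorem `f(τ, x, ·)` is a Maxwellian wherever positive. For any datum out of local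
equilibrium the reversed limit is therefore not the forward Boltzmann solution: convergence
holds for the marginals, while the full `N`-particle densities keep, on sets of vanishing
measure invisible to mode A, the information that drives them back. (`0 < t₁` is needed:
for `t₁ = 0` the hypothesis `hrev` is empty.) [cite: CIP1994, §4.7 (pp. 95–97) and BGSS 2018 §1] -/
def collisionOp_eq_zero_of_reversedSolution : Prop :=
  ∀ {T t₁ β : ℝ} (hβ : 0 < β) (ht₁ : t₁ ∈ Ioc 0 T) {f : ℝ → UnitAddTorus d → EuclideanSpace ℝ d → ℝ} (hfL : Literature.Analysis.FluidPDE.ContinuousInLanfordOn (Icc 0 T) β f) (hf : Literature.Analysis.FluidPDE.IsMildBoltzmannSolutionOn T (Literature.Analysis.FluidPDE.Torus.geometry d) hardSphereKernel f) (hrev : Literature.Analysis.FluidPDE.IsMildBoltzmannSolutionOn t₁ (Literature.Analysis.FluidPDE.Torus.geometry d) hardSphereKernel (reversedSolution f t₁)),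
    ∀ τ ∈ Icc 0 t₁, ∀ x v,
      Literature.Analysis.FluidPDE.collisionOpWith hardSphereKernel (f τ x) (f τ x) v = 0

end Irreversibility

/-! ## hilbert6.S14 (part): equilibrium fluctuations and the linearised Boltzmann equation -/

section Fluctuations

variable {X : Type*} [MeasureSpace X] [TopologicalSpace X]

/-- The grand-canonical expectation of an observable `F = (F_N)_N` on `⊔_N (X × ℝ^d)^N` in the
state `W`: `𝔼_W[F] = ∑_N (N!)⁻¹ ∫ W_N(Z_N) F_N(Z_N) dZ_N` (BGSS 2023 (1.1.5); the `1/N!` sits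
in the measure, see `Kinetic.GCState`). A `tsum` of Bochner integrals (junk `0`s). [cite: BGSS2023, (1.1.5] -/
def gcExpectation (W : Literature.Analysis.FluidPDE.GCState d X) (F : (N : ℕ) → Literature.Analysis.FluidPDE.Config N d X → ℝ) : ℝ :=
  ∑' N : ℕ, (N ! : ℝ)⁻¹ * ∫ Z, W N Z * F N Z

/-- The additive observable `Z_N ↦ ∑_i h(z_i)` (the unnormalised empirical measure tested
against `h`; BGSS 2023 (1.1.7): `π^ε_t(h) = μ_ε⁻¹ ∑_i h(z_i(t))`). [cite: BGSS2023, (1.1.7] -/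
def empiricalSum (h : X × EuclideanSpace ℝ d → ℝ) (N : ℕ) (Z : Literature.Analysis.FluidPDE.Config N d X) : ℝ :=
  ∑ i, h (Z i)

/-- The two-time covariance of the fluctuation field
`ζ^ε_t(h) = μ_ε^{1/2} (π^ε_t(h) - 𝔼_ε[π^ε_t(h)])`, `π^ε_t(h) = μ_ε⁻¹ ∑_i h(z_i(t))`, of a
grand-canonical hard-sphere gas with initial state `W` and sector flows `Φ N` (BGSS 2023
(1.1.7)–(1.2.1)): `𝔼_ε[ζ^ε_0(g) ζ^ε_t(h)] = μ⁻¹ (𝔼[S_0(g) S_t(h)] - 𝔼[S_0(g)] 𝔼[S_t(h)])`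
with `S_t(h)(Z_N) = 1_{good}(Z_N) ∑_i h((Φ^N_t Z_N)_i)` (the flow is junk off its good set,
which carries no `W`-mass when `W_N` vanishes off `D_ε^N`). [cite: BGSS2023, (1.1.7] -/
def fluctuationCovariance {G : Literature.Analysis.FluidPDE.Geometry d X} {ε : ℝ}
    (Φ : (N : ℕ) → Literature.Analysis.FluidPDE.HardSphereFlow G ε N) (μ : ℝ) (W : Literature.Analysis.FluidPDE.GCState d X)
    (g h : X × EuclideanSpace ℝ d → ℝ) (t : ℝ) : ℝ :=
  μ⁻¹ * (gcExpectation W (fun N Z => empiricalSum g N Z *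
      (Φ N).good.indicator (fun Z => empiricalSum h N ((Φ N).flow t Z)) Z) -
    gcExpectation W (empiricalSum g) *
      gcExpectation W (fun N => (Φ N).good.indicator fun Z => empiricalSum h N ((Φ N).flow t Z)))

/-- *Mild solution of the linearised hard-sphere Boltzmann equation on `[0, T]`*:
`∂ₜ g + v·∇ₓ g = L g`, `L` the linearised collision operator around the global Maxwellian
(`Literature.Analysis.UnboundedOperators.hardSphereLinearizedOp`, non-positive: `L g = M⁻¹ (Q(M, Mg) + Q(Mg, M))`), in Duhamel
form along free transport at every `(x, v)` (as `Kinetic.IsMildBoltzmannSolutionOn`; the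
operator `𝓛 g = -v·∇ₓ g + L g` of BGSS CPAM 2023 §1.2, display before Thm 1.1; CIP 1994 §7.1).
As in the prelude, no measurability of `g` in `v` is required, so `hardSphereLinearizedOp (g s y)`
is the Bochner junk `0` for non-measurable `g`; the statement below uses it for an
everywhere-defined representative of the `L²_M` solution issued from Lipschitz, compactly
supported data (classically — Grad's estimates on `K` in `L = -ν + K`, CIP 1994 §7.2 — such data
have a representative with `|g(t, x, v)| ≤ C_T M(v)^{-1/2}`, for which every collision integral
converges), and pins that solution down by an `L²_M` bound and by its covariances, not by a
uniform bound (which fails in general, see `fluctuationCovariance_tendsto`). [cite: BGSSCPAM2023, §1.2] -/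
structure IsMildLinearizedBoltzmannSolutionOn (T : ℝ) (G : Literature.Analysis.FluidPDE.Geometry d X)
    (g : ℝ → X → EuclideanSpace ℝ d → ℝ) : Prop where
  /-- The linearised collision term is integrable along every characteristic. -/
  intervalIntegrable : ∀ x v, ∀ t ∈ Icc 0 T,
    IntervalIntegrable
      (fun τ => Literature.Analysis.FluidPDE.alongFlow G (fun s y => Literature.Analysis.UnboundedOperators.hardSphereLinearizedOp (g s y)) τ x v) volume 0 t
  /-- Duhamel's formula along characteristics. -/
  duhamel : ∀ x v, ∀ t ∈ Icc 0 T, Literature.Analysis.FluidPDE.alongFlow G g t x v =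
    g 0 x v + ∫ τ in (0 : ℝ)..t,
      Literature.Analysis.FluidPDE.alongFlow G (fun s y => Literature.Analysis.UnboundedOperators.hardSphereLinearizedOp (g s y)) τ x v

/-- **hilbert6.S14** (part: equilibrium time-correlations of the fluctuation field are governed
by the linearised Boltzmann equation; Bodineau–Gallagher–Saint-Raymond–Simonella, CPAM 76
(2023) 3852–3911 *Long-time correlations for a hard-sphere gas at equilibrium* =
arXiv:2012.03813, Thm 1.1). PRINTED STATEMENT: consider hard spheres at equilibrium in the
`d`-dimensional periodic box, `d ≥ 3` (grand-canonical Gibbs measure (1.1.5) of activity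
`μ_ε = ε^{-(d-1)}` with Maxwellian velocities `M`); for `g₀, h ∈ L²_M` the covariance
`𝔼_ε(ζ^ε_0(g₀) ζ^ε_t(h))` of the fluctuation field
`ζ^ε_t(h) = μ_ε^{1/2} (π^ε_t(h) - 𝔼_ε π^ε_t(h))`, `π^ε_t(h) = μ_ε⁻¹ ∑ᵢ h(zᵢ(t))`, converges in the
Boltzmann–Grad limit `μ_ε → ∞`, for every `t ≥ 0`, to `∫ M g(t) h dx dv`, where `g` is the
solution of the linearised Boltzmann equation `∂ₜ g + v·∇ₓ g = L g`, `g(0) = g₀`; Remark 1.1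
there: that solution is unique and bounded globally in time in `L²_M` (the energy inequality
`‖g(t)‖_{L²_M} ≤ ‖g₀‖_{L²_M}` of Bodineau–Gallagher–Saint-Raymond, Ann. PDE 3 (2017), Prop. 9.2,
valid for every `d ≥ 2`), and the `d = 2` analogue is proved (ibid., Thm 1.2, Cor. 1.2) for the
canonical ensemble only. RENDERING: `3 ≤ card d`; the test functions are restricted to the
Lipschitz, compactly supported subclass of `L²_M` (on which the fluctuation observables are
finite sums); the limit `ε → 0` is taken along arbitrary sequences `ε_k → 0⁺` with `ε_k < 1/2`
(where the torus flow exists), in the equilibrium state `gcInitial (Torus.geometry d) ε_k μ_k M`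
(`μ_k = bgActivity d ε_k`, `M = globalMaxwellian`, invariant under the dynamics), the sector
flows `Φ k N` being quantified universally (they are Liouville-a.e. unique); "the solution" is
rendered existentially: for every `T > 0` there is a mild solution `g` on `[0, T]` (Duhamel
along characteristics, `IsMildLinearizedBoltzmannSolutionOn`) with `g(0) = g₀`, obeying the
printed `L²_M` energy bound `∫∫ M g(t)² ≤ ∫∫ M g₀²` on `[0, T]`, such that for *every* such `h`,
every `ε_k`, `Φ` and every `t ∈ [0, T]` the covariance (`fluctuationCovariance`) converges to
`∫∫ M(v) g(t, x, v) h(x, v) dx dv` — one `g` for the datum `g₀`, independent of `h`, `ε`, `Φ`;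
as `h` ranges over a separating class this determines `M g(t)` a.e., i.e. `g(t)` represents the
`L²_M` solution. RESTATED 2026-08-15 (verdict clean-up): the former rendering allowed `d = 2`
and demanded `sup_{[0,T] × T^d × ℝ^d} |g| < ∞`; that bound is not in the source and fails for
generic data (for spatially homogeneous, bounded, compactly supported `g₀` with `∫ M g₀ ≠ 0`
the collision frequency `ν(v) ≍ |v|` of `L = -ν + K` forces `|g(t, v)| ≍ t² |v|²` at large
`|v|` for every small `t > 0`), so the old statement was not dischargeable; the name is kept
(no users in the tree). [cite: BGSSCPAM2023, Thm 1.1] -/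
def fluctuationCovariance_tendsto : Prop :=
  ∀ (hd : 3 ≤ Fintype.card d) {g₀ : UnitAddTorus d × EuclideanSpace ℝ d → ℝ} (hg₀ : ∃ K, LipschitzWith K g₀) (hg₀c : HasCompactSupport g₀) {T : ℝ} (hT : 0 < T),
    ∃ g : ℝ → UnitAddTorus d → EuclideanSpace ℝ d → ℝ,
      IsMildLinearizedBoltzmannSolutionOn T (Literature.Analysis.FluidPDE.Torus.geometry d) g ∧ g 0 = curry g₀ ∧
      (∀ t ∈ Icc 0 T,
        Integrable (fun z : UnitAddTorus d × EuclideanSpace ℝ d =>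
          Literature.Analysis.FluidPDE.globalMaxwellian z.2 * g t z.1 z.2 ^ 2) ∧
        ∫ z : UnitAddTorus d × EuclideanSpace ℝ d,
            Literature.Analysis.FluidPDE.globalMaxwellian z.2 * g t z.1 z.2 ^ 2 ≤
          ∫ z : UnitAddTorus d × EuclideanSpace ℝ d,
            Literature.Analysis.FluidPDE.globalMaxwellian z.2 * g₀ z ^ 2) ∧
      ∀ h : UnitAddTorus d × EuclideanSpace ℝ d → ℝ, (∃ K, LipschitzWith K h) →
        HasCompactSupport h →
      ∀ ε : ℕ → ℝ, (∀ k, 0 < ε k) → (∀ k, ε k < 2⁻¹) → Tendsto ε atTop (𝓝 0) →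
      ∀ Φ : (k N : ℕ) → Literature.Analysis.FluidPDE.HardSphereFlow (Literature.Analysis.FluidPDE.Torus.geometry d) (ε k) N,
      ∀ t ∈ Icc 0 T,
        Tendsto (fun k => fluctuationCovariance (Φ k) (bgActivity d (ε k))
          (Literature.Analysis.FluidPDE.gcInitial (Literature.Analysis.FluidPDE.Torus.geometry d) (ε k) (bgActivity d (ε k))
            fun z => Literature.Analysis.FluidPDE.globalMaxwellian z.2) g₀ h t) atTop
          (𝓝 (∫ x, ∫ v, Literature.Analysis.FluidPDE.globalMaxwellian v * g t x v * h (x, v)))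

end Fluctuations

end

end Literature.MathematicalPhysics.KineticTheory
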